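/-
Copyright: rh-split cell (screw, bridge) gen 16, 2026-08-27.  Splitting search over kernel-typed
RH-equivalences; this module is ζ-free analysis.  Nothing here bears on the truth of RH.
-/
import Summits.RiemannHypothesis.RiemannHypothesis.Theorems.Splittings.ScrewBorelFluxB
import HarnessLib

/-!
# Gauss's law for a sign-definite Borel series — part A: slope terms, charges, flux of the slope series
(ζ-free kernel of row X-14; part B = `ScrewBorelGaussB`: Gauss's law and corollaries)

Data as in `ScrewBorelContinuation` / `ScrewBorelFlux`: `c : ι → ℂ` absolutely summable with
`Re (c i) < 0`, `u i ≠ 0`, the BOREL SERIES `B(z) = ∑' i, term (c i) (u i) z` and its INSIDE POLE SET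
`poleSet u ⊆ 𝔻`.

**The slope series.**  `B(0) = 0`, and off the poles `term c u z = z · slopeTerm c u z` with
`slopeTerm c u z = c·((1/2)·((u⁻¹ - z)⁻¹ + (u - z)⁻¹) - (1 - z)⁻¹)` — a WOLFF–DENJOY series `∑ A/(q - z)`
whose residue at each pole `q ∈ {u⁻¹, u}` is the PURE CHARGE `-c/2`, without the positional factor `q`
that the flux `∮ B dz` of `ScrewBorelFlux.circleIntegral_term` carries (`discWeight = (c/2)·q`).  So
`∮_{C(a,R)} slopeTerm c u = -2πi · chargeWeight c u a R`, `chargeWeight = (c/2)·#{poles of the term in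
ball a R}` (§3), and the real part of the total charge enclosed by a circle is a sum of NON-POSITIVE
terms, strictly negative as soon as one pole is enclosed.

**Gauss's law** (`poleSet_inter_ball_eq_empty`, §6).  Let `F` be holomorphic on the unit disc and equal
to `B` on a pole-free disc `ball 0 r₀`.  If a circle `sphere a R` with `closedBall a R ⊆ 𝔻` lies in a
preconnected set `V ∋ 0`, `V ⊆ 𝔻 ∖ closure (poleSet u)`, then `ball a R` contains NO inside pole.
Proof: `G = dslope F 0` (the difference quotient `(F z - F 0)/z`, holomorphic on `𝔻` by the removable
singularity theorem) agrees with the slope series on the punctured disc `ball 0 r₀ ∖ {0}` (§5), hence on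
`V` (identity theorem); Cauchy gives `∮_{C(a,R)} G = 0`; term by term (§4) `∮ slope series =
-2πi · ∑' chargeWeight`; the real part of `∑' chargeWeight` is `< 0` if a pole is enclosed.  ONE circle, ANY
centre, ANY radius: no shrinking, no Tannery limit, no metric or topological hypothesis on the wall.

Corollaries (§7): the CIRCLES theorem of `ScrewBorelFlux` at every scale (`false_of_circle`; it implies
`ScrewBorelFlux.false_of_small_circles` and `ScrewBorel.not_mem_closure_of_isolated`); the LASSO form
(`lt_norm_of_sphere_zero_subset`: an origin-centred circle `‖z‖ = r` linked to `0` off the wall forces every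
inside pole OUTSIDE it, `r < ‖p‖`; `poleSet_eq_empty_of_lassos`); the component form with
`Ω₀ = connectedComponentIn (𝔻 ∖ closure (poleSet u)) 0`.

Classical background: the residues of a Borel–Wolff–Denjoy series `∑ Aₙ/(z - zₙ)`, `∑ |Aₙ| < ∞`, are
conserved under analytic continuation into a hole of the pole set (Wolff's 1921 example `∑ r_k²/(z - z_k) =
ρ²/(z - a)` off a packed disc carries the total charge `∑ r_k² = ρ²` to the pole `a`; Ross–Shapiro,
Generalized Analytic Continuation, §4.2 and Thm 4.2.5 (Brown–Shields–Zeller)); with sign-definite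
residues a continuation holomorphic on the WHOLE hole is therefore impossible.  RH-side reading (module
`ScrewLatticeGauss`): under `CEIL(h)` the aliased far zeros of ζ avoid every disc whose boundary circle lies in
the origin's component of `𝔻 ∖ T_h`.

No `sorry`, no new axioms, no instances, no notation.
-/

set_option linter.dupNamespace false

namespace Summit.RiemannHypothesis.RiemannHypothesis.Theorems.Splittings.ScrewBorelGauss

open Complex Filter Topology Set Metric MeasureTheory
open scoped Real
open Summit.RiemannHypothesis.RiemannHypothesis.Theorems.Splittings.ScrewBorel
open Summit.RiemannHypothesis.RiemannHypothesis.Theorems.Splittings.ScrewBorelFlux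

/-! ## 1. The slope term -/

/-- The SLOPE TERM `slopeTerm c u z = c · ((1/2)·((u⁻¹ - z)⁻¹ + (u - z)⁻¹) - (1 - z)⁻¹)`: the Borel term
divided by `z` (`term_eq_mul_slopeTerm`), with residue `-c/2` at each of its poles `u⁻¹`, `u`. -/
noncomputable def slopeTerm (c u z : ℂ) : ℂ :=
  c * ((1 / 2) * ((u⁻¹ - z)⁻¹ + (u - z)⁻¹) - (1 - z)⁻¹)

/-- The Borel term vanishes at the origin. -/
theorem term_zero (c u : ℂ) : term c u 0 = 0 := by
  unfold term; norm_num

/-- The Borel series vanishes at the origin. -/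
theorem borel_zero {ι : Type*} (c u : ι → ℂ) : (∑' i, term (c i) (u i) 0) = 0 := by
  simp [term_zero]

/-- Off the three poles: `term c u z = z · slopeTerm c u z`. -/
theorem term_eq_mul_slopeTerm {c u z : ℂ} (hu : u ≠ 0) (h1 : 1 - u * z ≠ 0) (h2 : 1 - z / u ≠ 0)
    (h3 : 1 - z ≠ 0) : term c u z = z * slopeTerm c u z := by
  have n1 : u⁻¹ - z ≠ 0 := by
    intro h
    apply h1
    have hz : u⁻¹ = z := sub_eq_zero.1 h
    rw [← hz, mul_inv_cancel₀ hu, sub_self]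
  have n2 : u - z ≠ 0 := by
    intro h
    apply h2
    have hz : u = z := sub_eq_zero.1 h
    rw [← hz, div_self hu, sub_self]
  have hA : (1 - u * z)⁻¹ = 1 + z * (u⁻¹ - z)⁻¹ := by
    have e : 1 - u * z = u * (u⁻¹ - z) := by rw [mul_sub, mul_inv_cancel₀ hu]
    rw [e, mul_inv]
    field_simp
    ring
  have hB : (1 - z / u)⁻¹ = 1 + z * (u - z)⁻¹ := by
    have e : 1 - z / u = u⁻¹ * (u - z) := by rw [mul_sub, inv_mul_cancel₀ hu, div_eq_inv_mul]
    rw [e, mul_inv, inv_inv]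
    field_simp
    ring
  have hC : (1 - z)⁻¹ = 1 + z * (1 - z)⁻¹ := by
    field_simp
    ring
  unfold term slopeTerm
  linear_combination (c / 2) * hA + (c / 2) * hB - c * hC

/-! ## 2. Bounds and differentiability of the slope term; the slope series is holomorphic off the wall -/

/-- A point `q` and `z` with `‖z‖ ≤ r`, `δ ≤ 1 - r`: if `δ ≤ ‖q - z‖` whenever `‖q‖ < 1`, then
`δ ≤ ‖q - z‖` outright. -/
theorem le_norm_sub_of_pole {q z : ℂ} {r δ : ℝ} (hδr : δ ≤ 1 - r) (hz : ‖z‖ ≤ r)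
    (hfar : ‖q‖ < 1 → δ ≤ ‖q - z‖) : δ ≤ ‖q - z‖ := by
  rcases lt_or_ge ‖q‖ 1 with h | h
  · exact hfar h
  · have := norm_sub_norm_le q z
    linarith

/-- Uniform bound: `‖z‖ ≤ r`, `0 < δ ≤ 1 - r`, `z` `δ`-away from the inside poles of the term ⟹
`‖slopeTerm c u z‖ ≤ 2‖c‖/δ`. -/
theorem norm_slopeTerm_le {c u z : ℂ} {r δ : ℝ} (hδ : 0 < δ) (hδr : δ ≤ 1 - r) (hz : ‖z‖ ≤ r)
    (hfar₁ : ‖u⁻¹‖ < 1 → δ ≤ ‖u⁻¹ - z‖) (hfar₂ : ‖u‖ < 1 → δ ≤ ‖u - z‖) :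
    ‖slopeTerm c u z‖ ≤ 2 * ‖c‖ / δ := by
  have h1 := norm_inv_le_of_le hδ (le_norm_sub_of_pole hδr hz hfar₁)
  have h2 := norm_inv_le_of_le hδ (le_norm_sub_of_pole hδr hz hfar₂)
  have h3 := norm_inv_le_of_le hδ (hδr.trans (one_sub_le_norm_one_sub hz))
  unfold slopeTerm
  rw [norm_mul]
  have hin : ‖(1 / 2 : ℂ) * ((u⁻¹ - z)⁻¹ + (u - z)⁻¹) - (1 - z)⁻¹‖ ≤ 2 / δ := by
    calc ‖(1 / 2 : ℂ) * ((u⁻¹ - z)⁻¹ + (u - z)⁻¹) - (1 - z)⁻¹‖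
        ≤ ‖(1 / 2 : ℂ) * ((u⁻¹ - z)⁻¹ + (u - z)⁻¹)‖ + ‖(1 - z)⁻¹‖ := norm_sub_le _ _
      _ ≤ (1 / 2) * (δ⁻¹ + δ⁻¹) + δ⁻¹ := by
          gcongr
          rw [norm_mul]
          have : ‖(1 / 2 : ℂ)‖ = 1 / 2 := by simp
          rw [this]
          gcongr
          exact (norm_add_le _ _).trans (add_le_add h1 h2)
      _ = 2 / δ := by ring
  calc ‖c‖ * ‖(1 / 2 : ℂ) * ((u⁻¹ - z)⁻¹ + (u - z)⁻¹) - (1 - z)⁻¹‖ ≤ ‖c‖ * (2 / δ) := by gcongr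
    _ = 2 * ‖c‖ / δ := by ring

/-- Differentiability of the slope term where its three denominators do not vanish. -/
theorem differentiableAt_slopeTerm {c u z : ℂ} (h1 : u⁻¹ - z ≠ 0) (h2 : u - z ≠ 0)
    (h3 : 1 - z ≠ 0) : DifferentiableAt ℂ (fun w ↦ slopeTerm c u w) z := by
  unfold slopeTerm
  have d1 : DifferentiableAt ℂ (fun w : ℂ ↦ (u⁻¹ - w)⁻¹) z :=
    ((differentiableAt_const _).sub differentiableAt_id).inv h1
  have d2 : DifferentiableAt ℂ (fun w : ℂ ↦ (u - w)⁻¹) z :=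
    ((differentiableAt_const _).sub differentiableAt_id).inv h2
  have d3 : DifferentiableAt ℂ (fun w : ℂ ↦ (1 - w)⁻¹) z :=
    ((differentiableAt_const _).sub differentiableAt_id).inv h3
  exact (differentiableAt_const c).mul (((differentiableAt_const _).mul (d1.add d2)).sub d3)

/-- **The slope series is complex-differentiable on `ball 0 1 ∖ closure (poleSet u)`.** -/
theorem differentiableOn_slopeSeries {ι : Type*} {c u : ι → ℂ} (hc : Summable fun i ↦ ‖c i‖) :
    DifferentiableOn ℂ (fun z ↦ ∑' i, slopeTerm (c i) (u i) z)
      (ball 0 1 \ closure (poleSet u)) := by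
  intro z₀ hz₀
  obtain ⟨δ, r, hδ, hδr, hzr, hfar⟩ := exists_local_gap hz₀.1 hz₀.2
  have hpole₁ : ∀ z ∈ ball z₀ δ, ∀ i, ‖(u i)⁻¹‖ < 1 → δ ≤ ‖(u i)⁻¹ - z‖ :=
    fun z hz i hi ↦ hfar z hz _ ⟨hi, i, Or.inr rfl⟩
  have hpole₂ : ∀ z ∈ ball z₀ δ, ∀ i, ‖u i‖ < 1 → δ ≤ ‖u i - z‖ :=
    fun z hz i hi ↦ hfar z hz _ ⟨hi, i, Or.inl rfl⟩
  have hdiff : DifferentiableOn ℂ (fun z ↦ ∑' i, slopeTerm (c i) (u i) z) (ball z₀ δ) := by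
    refine differentiableOn_tsum_of_summable_norm (u := fun i ↦ 2 * ‖c i‖ / δ)
      ((hc.mul_left 2).div_const δ) (fun i z hz ↦ ?_) isOpen_ball (fun i z hz ↦ ?_)
    · have e1 := le_norm_sub_of_pole hδr (hzr z hz) (hpole₁ z hz i)
      have e2 := le_norm_sub_of_pole hδr (hzr z hz) (hpole₂ z hz i)
      have e3 := hδr.trans (one_sub_le_norm_one_sub (hzr z hz))
      have n1 : (u i)⁻¹ - z ≠ 0 := fun h ↦ by rw [h, norm_zero] at e1; linarith
      have n2 : u i - z ≠ 0 := fun h ↦ by rw [h, norm_zero] at e2; linarith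
      have n3 : 1 - z ≠ 0 := fun h ↦ by rw [h, norm_zero] at e3; linarith
      exact (differentiableAt_slopeTerm n1 n2 n3).differentiableWithinAt
    · exact norm_slopeTerm_le hδ hδr (hzr z hz) (hpole₁ z hz i) (hpole₂ z hz i)
  exact (hdiff.differentiableAt (ball_mem_nhds z₀ hδ)).differentiableWithinAt

/-! ## 3. Circle integrals: the flux of a slope term is its enclosed CHARGE -/

/-- The CHARGE the term `(c, u)` puts on the disc `ball a R`: `c/2` for each of its poles `q ∈ {u⁻¹, u}`
enclosed by the circle `sphere a R` (compare `ScrewBorelFlux.discWeight = (c/2)·q`). -/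
noncomputable def chargeWeight (c u a : ℂ) (R : ℝ) : ℂ :=
  (if ‖u⁻¹ - a‖ < R then c / 2 else 0) + (if ‖u - a‖ < R then c / 2 else 0)

/-- **Polar piece.**  For `q` off the circle `sphere a R` (`R > 0`):
`∮_{C(a,R)} (q - z)⁻¹ dz = -2πi` if `‖q - a‖ < R`, and `= 0` otherwise. -/
theorem circleIntegral_inv_sub {q a : ℂ} {R : ℝ} (hR : 0 < R) (hqs : q ∉ sphere a R) :
    (∮ z in C(a, R), (q - z)⁻¹) = if ‖q - a‖ < R then -(2 * π * I) else 0 := by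
  split_ifs with hin
  · have hmem : q ∈ ball a R := by rwa [mem_ball, dist_eq_norm]
    have e : EqOn (fun z : ℂ ↦ (q - z)⁻¹) (fun z ↦ (-1) * (z - q)⁻¹) (sphere a R) := by
      intro z _
      show (q - z)⁻¹ = (-1) * (z - q)⁻¹
      rw [← neg_sub z q, inv_neg]; ring
    rw [circleIntegral.integral_congr hR.le e, circleIntegral.integral_const_mul,
      circleIntegral.integral_sub_inv_of_mem_ball hmem]
    ring
  · have hne : ‖q - a‖ ≠ R := by rwa [mem_sphere, dist_eq_norm] at hqs
    have hout : R < ‖q - a‖ := lt_of_le_of_ne (not_lt.1 hin) (Ne.symm hne)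
    have hden : ∀ z ∈ closedBall a R, q - z ≠ 0 := by
      intro z hz h
      have hqz : q = z := sub_eq_zero.1 h
      rw [mem_closedBall, dist_eq_norm, ← hqz] at hz
      linarith
    have hd : ∀ z ∈ closedBall a R, DifferentiableAt ℂ (fun w : ℂ ↦ (q - w)⁻¹) z :=
      fun z hz ↦ ((differentiableAt_const _).sub differentiableAt_id).inv (hden z hz)
    exact circleIntegral_eq_zero_of_differentiable_on_off_countable hR.le countable_empty
      (fun z hz ↦ (hd z hz).continuousAt.continuousWithinAt)
      (fun z hz ↦ hd z (ball_subset_closedBall hz.1))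

/-- **Flux of one slope term = its enclosed charge.**  If `closedBall a R ⊆ 𝔻` (`R > 0`) and the poles
`u`, `u⁻¹` are off the circle, then `∮_{C(a,R)} slopeTerm c u = -2πi · chargeWeight c u a R`. -/
theorem circleIntegral_slopeTerm {c u a : ℂ} {R : ℝ} (hR : 0 < R)
    (hsub : closedBall a R ⊆ ball (0 : ℂ) 1) (hus : u ∉ sphere a R) (huis : u⁻¹ ∉ sphere a R) :
    (∮ z in C(a, R), slopeTerm c u z) = -(2 * π * I) * chargeWeight c u a R := by
  have h1s : (1 : ℂ) ∉ sphere a R := fun h ↦ by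
    have := hsub (sphere_subset_closedBall h)
    rw [mem_ball_zero_iff, norm_one] at this
    exact lt_irrefl _ this
  have h1n : ¬ ‖(1 : ℂ) - a‖ < R := fun h ↦ by
    have h1 : (1 : ℂ) ∈ closedBall a R := by rw [mem_closedBall, dist_eq_norm]; exact h.le
    have := hsub h1
    rw [mem_ball_zero_iff, norm_one] at this
    exact lt_irrefl _ this
  have I1 : (∮ z in C(a, R), ((1 : ℂ) - z)⁻¹) = 0 := by
    have h := circleIntegral_inv_sub (q := (1 : ℂ)) hR h1s
    rwa [if_neg h1n] at h
  have I2 := circleIntegral_inv_sub (q := u) hR hus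
  have I3 := circleIntegral_inv_sub (q := u⁻¹) hR huis
  have cint : ∀ q : ℂ, q ∉ sphere a R → CircleIntegrable (fun z : ℂ ↦ (q - z)⁻¹) a R := by
    intro q hq
    refine ContinuousOn.circleIntegrable hR.le fun z hz ↦ ?_
    have hne : q - z ≠ 0 := by
      intro h
      have hqz : q = z := sub_eq_zero.1 h
      exact hq (by rw [hqz]; exact hz)
    have hd : DifferentiableAt ℂ (fun w : ℂ ↦ (q - w)⁻¹) z :=
      ((differentiableAt_const _).sub differentiableAt_id).inv hne
    exact hd.continuousAt.continuousWithinAt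
  have c1 := cint _ huis
  have c2 := cint _ hus
  have c3 := cint _ h1s
  have c12 : CircleIntegrable (fun z : ℂ ↦ (1 / 2 : ℂ) * ((u⁻¹ - z)⁻¹ + (u - z)⁻¹)) a R :=
    IntervalIntegrable.const_mul (c1.add c2) (1 / 2 : ℂ)
  have e : (fun z : ℂ ↦ slopeTerm c u z) =
      fun z ↦ c * ((1 / 2) * ((u⁻¹ - z)⁻¹ + (u - z)⁻¹) - (1 - z)⁻¹) := rfl
  rw [e, circleIntegral.integral_const_mul, circleIntegral.integral_sub c12 c3,
    circleIntegral.integral_const_mul, circleIntegral.integral_add c1 c2, I1, I2, I3]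
  unfold chargeWeight
  split_ifs <;> ring

/-- `‖chargeWeight c u a R‖ ≤ ‖c‖`. -/
theorem norm_chargeWeight_le (c u a : ℂ) (R : ℝ) : ‖chargeWeight c u a R‖ ≤ ‖c‖ := by
  unfold chargeWeight
  have h2 : ‖c / 2‖ = ‖c‖ / 2 := by rw [norm_div]; simp
  have h0 := norm_nonneg c
  refine (norm_add_le _ _).trans ?_
  split_ifs <;> simp only [norm_zero, h2] <;> linarith

/-- The real part of the charge is non-positive … -/
theorem re_chargeWeight_nonpos {c : ℂ} (hc : c.re < 0) (u a : ℂ) (R : ℝ) :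
    (chargeWeight c u a R).re ≤ 0 := by
  unfold chargeWeight
  have h2 : (c / 2).re = c.re / 2 := Complex.div_ofNat_re c 2
  rw [Complex.add_re]
  split_ifs <;> simp only [Complex.zero_re, h2] <;> linarith

/-- … and strictly negative as soon as one pole of the term is enclosed. -/
theorem re_chargeWeight_neg {c : ℂ} (hc : c.re < 0) {u a p : ℂ} {R : ℝ} (hp : ‖p - a‖ < R)
    (hpu : p = u ∨ p = u⁻¹) : (chargeWeight c u a R).re < 0 := by
  unfold chargeWeight
  have h2 : (c / 2).re = c.re / 2 := Complex.div_ofNat_re c 2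
  rw [Complex.add_re]
  rcases hpu with rfl | rfl
  · rw [if_pos hp]
    split_ifs <;> simp only [Complex.zero_re, h2] <;> linarith
  · rw [if_pos hp]
    split_ifs <;> simp only [Complex.zero_re, h2] <;> linarith

/-! ## 4. Flux of the slope series: term-by-term integration on a separated circle -/

/-- **`∮ slope series = ∑' i, ∮ slopeTermᵢ`** on a circle `sphere a R` whose points have norm `≤ r'` and
which stays `δ`-away from the inside pole set, `0 < δ ≤ 1 - r'` (dominated convergence on `[0, 2π]`). -/
theorem hasSum_circleIntegral_slope {ι : Type*} [Countable ι] {c u : ι → ℂ}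
    (hc : Summable fun i ↦ ‖c i‖) {a : ℂ} {R : ℝ} (hR : 0 < R) {r' δ : ℝ}
    (hδ : 0 < δ) (hδr : δ ≤ 1 - r') (hzr : ∀ z ∈ sphere a R, ‖z‖ ≤ r')
    (hfar : ∀ z ∈ sphere a R, ∀ q ∈ poleSet u, δ ≤ ‖q - z‖) :
    HasSum (fun i ↦ ∮ z in C(a, R), slopeTerm (c i) (u i) z)
      (∮ z in C(a, R), ∑' i, slopeTerm (c i) (u i) z) := by
  have hfar₁ : ∀ z ∈ sphere a R, ∀ i, ‖(u i)⁻¹‖ < 1 → δ ≤ ‖(u i)⁻¹ - z‖ :=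
    fun z hz i hi ↦ hfar z hz _ ⟨hi, i, Or.inr rfl⟩
  have hfar₂ : ∀ z ∈ sphere a R, ∀ i, ‖u i‖ < 1 → δ ≤ ‖u i - z‖ :=
    fun z hz i hi ↦ hfar z hz _ ⟨hi, i, Or.inl rfl⟩
  have hbd : ∀ z ∈ sphere a R, ∀ i, ‖slopeTerm (c i) (u i) z‖ ≤ 2 * ‖c i‖ / δ :=
    fun z hz i ↦ norm_slopeTerm_le hδ hδr (hzr z hz) (hfar₁ z hz i) (hfar₂ z hz i)
  have hda : ∀ z ∈ sphere a R, ∀ i, DifferentiableAt ℂ (fun w ↦ slopeTerm (c i) (u i) w) z := by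
    intro z hz i
    have e1 := le_norm_sub_of_pole hδr (hzr z hz) (hfar₁ z hz i)
    have e2 := le_norm_sub_of_pole hδr (hzr z hz) (hfar₂ z hz i)
    have e3 := hδr.trans (one_sub_le_norm_one_sub (hzr z hz))
    have n1 : (u i)⁻¹ - z ≠ 0 := fun h ↦ by rw [h, norm_zero] at e1; linarith
    have n2 : u i - z ≠ 0 := fun h ↦ by rw [h, norm_zero] at e2; linarith
    have n3 : 1 - z ≠ 0 := fun h ↦ by rw [h, norm_zero] at e3; linarith
    exact differentiableAt_slopeTerm n1 n2 n3
  have hsm : ∀ θ : ℝ, circleMap a R θ ∈ sphere a R := fun θ ↦ circleMap_mem_sphere a hR.le θ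
  have hsb : Summable fun i ↦ 2 * ‖c i‖ / δ := (hc.mul_left 2).div_const δ
  simp only [circleIntegral]
  refine intervalIntegral.hasSum_integral_of_dominated_convergence
    (fun i _ ↦ R * (2 * ‖c i‖ / δ)) (fun i ↦ ?_) (fun i ↦ ?_) ?_ ?_ ?_
  · refine Continuous.aestronglyMeasurable ?_
    have h1 : Continuous fun θ : ℝ ↦ deriv (circleMap a R) θ := by
      simp only [deriv_circleMap]; exact (continuous_circleMap 0 R).fun_mul continuous_const
    have h2 : Continuous fun θ : ℝ ↦ slopeTerm (c i) (u i) (circleMap a R θ) :=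
      continuous_iff_continuousAt.2 fun θ ↦
        ((hda _ (hsm θ) i).continuousAt).comp (continuous_circleMap a R).continuousAt
    exact h1.fun_smul h2
  · refine Eventually.of_forall fun θ _ ↦ ?_
    rw [norm_smul, deriv_circleMap, norm_mul, norm_circleMap_zero, Complex.norm_I, mul_one,
      abs_of_pos hR]
    exact mul_le_mul_of_nonneg_left (hbd _ (hsm θ) i) hR.le
  · exact Eventually.of_forall fun θ _ ↦ hsb.mul_left R
  · exact intervalIntegrable_const
  · refine Eventually.of_forall fun θ _ ↦ HasSum.const_smul _ ?_
    exact (Summable.of_norm_bounded hsb (fun i ↦ hbd _ (hsm θ) i)).hasSum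

end Summit.RiemannHypothesis.RiemannHypothesis.Theorems.Splittings.ScrewBorelGauss
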